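import Literature.Analysis.FluidPDE.RusinSverakWeakLimitBlowupFourLeaves
import Literature.Analysis.FluidPDE.LocalEnergyExtensionHolds
import Literature.Analysis.FluidPDE.LocalLerayWeakStrongUniquenessHolds
import Literature.Analysis.FluidPDE.JiaSverak2013Lemma8Holds
import Literature.Analysis.FluidPDE.LocalLerayLimitIdentification
import HarnessLib

/-!
# Rusin–Šverák, Cor. 4.3 HOLDS: the set of `Ḣ^{1/2}`-minimal blow-up data is non-empty and
# compact modulo scalings and translations (discharge of `rusin_sverak_minimal_data_compact`,
# `rusin_sverak_minimal_blowup`, `rusin_sverak_weak_limit_blowup`, `rusin_sverak_weak_limit_of_singular_points`)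

Topic `Analysis/FluidPDE`. W. Rusin, V. Šverák, *Minimal initial data for potential Navier–Stokes
singularities*, J. Funct. Anal. 260 (2011) 879–891 = arXiv:0911.0500, Cor. 4.3 (p. 8): "The set
`M` is non-empty. Moreover, `M` is compact modulo scalings and translations".

The tree reduced both clauses (and the intermediate statements of the printed proof, Cor. 4.2 at
the level of data **C** = `rusin_sverak_weak_limit_of_singular_points` and sentences 2–4 of the
proof of Cor. 4.3, `rusin_sverak_weak_limit_blowup`) to exactly four leaves of the local Leray
theory (`RusinSverakWeakLimitBlowupFourLeaves.lean`, "the discharges are the one-liners … to be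
placed in a sibling `…Holds.lean` importing this file and the four leaf discharges"):

1. **F2** `localEnergySolution_extension_of_memE2` — now `localEnergySolution_extension_of_memE2_holds`
   (`LocalEnergyExtensionHolds.lean`; Seregin 2014 App. B §B.5, Lemarié-Rieusset 2016 Thm. 14.8);
2. **U** `local_leray_weak_strong_uniqueness` — now `local_leray_weak_strong_uniqueness_holds`
   (`LocalLerayWeakStrongUniquenessHolds.lean`; Lemarié-Rieusset 2016 Thm. 14.7);
3. **J8** `jia_sverak_2013_lemma_8` — now `jia_sverak_2013_lemma_8_holds`
   (`JiaSverak2013Lemma8Holds.lean`; Jia–Šverák 2013 Lemma 8);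
4. **Lim** `localLeray_limit_isLocalLeraySolution` — now `localLeray_limit_isLocalLeraySolution_holds`
   (`LocalLerayLimitIdentification.lean`; Jia–Šverák 2013, proof of Thm. 1; Seregin 2014 Thm. 1.6).

This file is that sibling: it composes the accepted assemblies with the four leaf discharges.
No definition and no named fact is introduced.

## References

* W. Rusin, V. Šverák, J. Funct. Anal. 260 (2011) 879–891; arXiv:0911.0500, Cor. 4.2, Cor. 4.3
  and its proof (p. 8). [RusinSverak2011]
* H. Jia, V. Šverák, *Minimal L³-initial data for potential Navier–Stokes singularities*, SIAM J.
  Math. Anal. 45 (2013); arXiv:1201.1592, Lemma 8, proof of Thm. 1. [JiaSverak2013]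
* P. G. Lemarié-Rieusset, *The Navier–Stokes problem in the 21st century* (2016), Thms. 14.7, 14.8.
  [LemarieRieusset2016]
* G. Seregin, *Lecture notes on regularity theory for the Navier–Stokes equations* (2014), App. B.
  [Seregin2014Notes]
-/

noncomputable section

namespace Literature.Analysis.FluidPDE

/-- **Rusin–Šverák Cor. 4.2 at the level of data holds** (`rusin_sverak_weak_limit_of_singular_points`,
**C**): over the four discharged leaves F2, U, J8, Lim.
[cite: RusinSverak2011, Cor. 4.2 and proof of Cor. 4.3 (arXiv:0911.0500 pp. 7–8)] -/
theorem rusin_sverak_weak_limit_of_singular_points_holds :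
    rusin_sverak_weak_limit_of_singular_points :=
  rusin_sverak_weak_limit_of_singular_points_of_four_leaves
    localEnergySolution_extension_of_memE2_holds local_leray_weak_strong_uniqueness_holds
    jia_sverak_2013_lemma_8_holds localLeray_limit_isLocalLeraySolution_holds

/-- **The weak-limit blow-up of the proof of Cor. 4.3 holds** (`rusin_sverak_weak_limit_blowup`,
sentences 2–4 of the printed proof). [cite: RusinSverak2011, proof of Cor. 4.3, sentences 2–4 (arXiv:0911.0500 p. 8)] -/
theorem rusin_sverak_weak_limit_blowup_holds : rusin_sverak_weak_limit_blowup :=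
  rusin_sverak_weak_limit_blowup_of_four_leaves
    localEnergySolution_extension_of_memE2_holds local_leray_weak_strong_uniqueness_holds
    jia_sverak_2013_lemma_8_holds localLeray_limit_isLocalLeraySolution_holds

/-- **Rusin–Šverák Cor. 4.3, second clause, holds**: the set of `Ḣ^{1/2}`-minimal blow-up data
is compact modulo scalings and translations (`rusin_sverak_minimal_data_compact`,
`RusinSverakCompactness.lean`). [cite: RusinSverak2011, Cor. 4.3, second clause (arXiv:0911.0500 p. 8)] -/
theorem rusin_sverak_minimal_data_compact_holds : rusin_sverak_minimal_data_compact :=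
  rusin_sverak_minimal_data_compact_of_four_leaves
    localEnergySolution_extension_of_memE2_holds local_leray_weak_strong_uniqueness_holds
    jia_sverak_2013_lemma_8_holds localLeray_limit_isLocalLeraySolution_holds

/-- **Rusin–Šverák Cor. 4.3, first clause, holds** (ns.S14, `rusin_sverak_minimal_blowup`,
`MildSolutions.lean`): if `ρ_max < ∞`, some weakly divergence-free `Ḣ^{1/2}` datum of norm exactly
`ρ_max` has no global Kato solution. [cite: RusinSverak2011, Cor. 4.3, first clause (arXiv:0911.0500 p. 8)] -/
theorem rusin_sverak_minimal_blowup_holds : rusin_sverak_minimal_blowup :=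
  rusin_sverak_minimal_blowup_of_four_leaves
    localEnergySolution_extension_of_memE2_holds local_leray_weak_strong_uniqueness_holds
    jia_sverak_2013_lemma_8_holds localLeray_limit_isLocalLeraySolution_holds

end Literature.Analysis.FluidPDE

end
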